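import Summits.Ventures.PercRepro.ExcessOneSingleton

/-!
# The excess-one Lemma B at a tight trace with empty partner family

Let `F` be a twin-free family without trivial elements and without complementary pairs,
`|F \\ F| ≤ |F| + 1`, and let `r` be an element with `{r} ∈ F` whose trace `proj r F` is tight and
whose partner family is empty. Then `partr r F = {∅}`: the only member containing `r` is `{r}`
(`partr_eq_singleton_empty_of_partner_eq_empty`). This is Lemma (B3)₀ of
proofs/MINE1-theoremS.md, Addendum 22, supplement 1.

Proof sketch. The trace `P` is tight and contains `∅`, so it is convex from `∅`: every twin-closed
subset of a member is a member, in particular every singleton. With an empty partner family the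
identity `|F \\ F| = |P \\ P| + |X ∩ Y|` leaves room for a single collision, which is `∅`
(`{r} ∈ F`). By (SD) every singleton `{x}` is a difference avoiding `r`, so no pair `(t, s)` with
`t ∈ partr r F`, `s ∈ part0 r F` has a singleton difference; hence `partr r F` is closed under
erasing elements, every element of a member of `partr r F` gives a singleton member of
`partr r F`, and such an element lies in every member of `part0 r F`. If `partr r F ≠ {∅}`, every
element `y ≠ r` would then lie in a member of `partr r F` (else `{y} ∈ part0 r F` would contain the
others), so every member of `part0 r F` would be `univ \ {r}` — a complementary pair with `{r}`.
-/

namespace PercRepro.MSTight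

open Finset
open scoped FinsetFamily

variable {α : Type*} [DecidableEq α] [Fintype α]

section EmptyPartner

variable {F : Finset (Finset α)} {r : α}

/-- **(B3)₀.** `F` twin-free, every element in some member and outside some member, no
complementary pair, `|F \\ F| ≤ |F| + 1`, `{r} ∈ F`, `proj r F` tight, `partner r F = ∅`.
Then `partr r F = {∅}`. -/
theorem partr_eq_singleton_empty_of_partner_eq_empty
    (htf : ∀ a b, Twin F a b → a = b) (hin : ∀ a, ∃ t ∈ F, a ∈ t) (hout : ∀ a, ∃ t ∈ F, a ∉ t)
    (hval : ∀ t ∈ F, univ \ t ∉ F) (hF : (F \\ F).card ≤ F.card + 1)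
    (hP : Tight (proj r F)) (hr : ({r} : Finset α) ∈ F) (hK : partner r F = ∅) :
    partr r F = {∅} := by
  -- basic facts
  have h0 : (∅ : Finset α) ∈ partr r F := mem_partr.2 ⟨notMem_empty r, by simpa using hr⟩
  have h0P : (∅ : Finset α) ∈ proj r F := by
    rw [proj_eq_union]
    exact mem_union_right _ h0
  have hPF : (proj r F).card = F.card := by
    rw [card_eq_card_proj_add_card_partner r F, hK, card_empty, add_zero]
  -- singletons `{x}`, `x ≠ r`, are twin-closed for the trace and are members of the trace
  have htwP : ∀ x, x ≠ r → TwinClosed (proj r F) ({x} : Finset α) := by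
    intro x hx a b hab ha
    rw [mem_singleton] at ha ⊢
    rw [ha] at hab
    exact twin_proj_eq_of_twin_eq hx (fun b' hb' => (htf _ _ hb').symm) (hin x) b hab
  have hsingP : ∀ x, x ≠ r → ({x} : Finset α) ∈ proj r F := by
    intro x hx
    obtain ⟨t, ht, hxt⟩ := hin x
    refine mem_of_subset_of_subset_of_twinClosed_of_tight hP h0P (mem_proj.2 ⟨t, ht, rfl⟩)
      (empty_subset _) ?_ (htwP x hx)
    intro z hz
    rw [mem_singleton] at hz
    rw [hz]
    exact mem_erase.2 ⟨hx, hxt⟩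
  -- the only collision is `∅`
  have hXY : ∀ E ∈ diffsX r F ∩ diffsY r F, E = ∅ := by
    have h1 := card_diffs_eq_card_diffs_proj_add r F
    have h2 : (proj r F \\ proj r F).card = (proj r F).card := hP
    have h3 : (diffsX r F ∩ diffsY r F).card ≤ 1 := by omega
    obtain ⟨s, hs, hrs⟩ := hout r
    have h0XY : (∅ : Finset α) ∈ diffsX r F ∩ diffsY r F := by
      refine mem_inter.2 ⟨mem_diffsX_iff.2 ⟨?_, notMem_empty r⟩, mem_diffsY_iff.2 ⟨notMem_empty r, ?_⟩⟩
      · exact mem_diffs.2 ⟨s, hs, s, hs, Finset.sdiff_self s⟩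
      · rw [insert_empty]
        exact mem_diffs.2 ⟨{r}, hr, s, hs, by
          ext z
          simp only [mem_sdiff, mem_singleton]
          constructor
          · rintro ⟨rfl, -⟩
            rfl
          · rintro rfl
            exact ⟨rfl, hrs⟩⟩
    intro E hE
    by_contra hne
    have : 1 < (diffsX r F ∩ diffsY r F).card := one_lt_card.2 ⟨E, hE, ∅, h0XY, hne⟩
    omega
  -- every singleton `{x}`, `x ≠ r`, is a difference avoiding `r`
  have hsingX : ∀ x, x ≠ r → ({x} : Finset α) ∈ diffsX r F := by
    intro x hx
    refine mem_diffsX_iff.2 ⟨?_, by rw [mem_singleton]; exact Ne.symm hx⟩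
    exact singleton_mem_diffs_of_card_diffs_le hF (fun b hb => (htf _ _ hb).symm) (hin x) (hout x)
  -- no pair `(t ∈ partr, s ∈ part0)` has a singleton difference
  have hnosing : ∀ t ∈ partr r F, ∀ s ∈ part0 r F, ∀ x, t \ s ≠ {x} := by
    intro t ht s hs x htsx
    have hxr : x ≠ r := by
      rintro rfl
      have : x ∈ t \ s := by rw [htsx]; exact mem_singleton_self x
      exact (mem_partr.1 ht).1 (mem_sdiff.1 this).1
    have hY : ({x} : Finset α) ∈ diffsY r F := by
      rw [← htsx]
      exact sdiff_mem_diffs ht hs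
    have := hXY _ (mem_inter.2 ⟨hsingX x hxr, hY⟩)
    exact singleton_ne_empty x this
  -- `partr r F` is closed under erasing an element
  have herase : ∀ t ∈ partr r F, ∀ x ∈ t, t.erase x ∈ partr r F := by
    intro t ht x hxt
    have hxr : x ≠ r := fun h => (mem_partr.1 ht).1 (h ▸ hxt)
    have htP : t ∈ proj r F := by
      rw [proj_eq_union]
      exact mem_union_right _ ht
    have hteP : t.erase x ∈ proj r F := by
      refine mem_of_subset_of_subset_of_twinClosed_of_tight hP h0P htP (empty_subset _)
        (erase_subset x t) ?_
      rw [erase_eq]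
      exact (twinClosed_of_mem htP).sdiff (htwP x hxr)
    rw [proj_eq_union, mem_union] at hteP
    rcases hteP with h | h
    · exfalso
      refine hnosing t ht _ h x ?_
      ext z
      simp only [mem_sdiff, mem_erase, mem_singleton]
      constructor
      · rintro ⟨hz, hz'⟩
        by_contra hzx
        exact hz' ⟨hzx, hz⟩
      · rintro rfl
        exact ⟨hxt, fun h' => h'.1 rfl⟩
    · exact h
  -- every element of a member of `partr r F` gives a singleton member of `partr r F`
  have hsing1 : ∀ t ∈ partr r F, ∀ x ∈ t, ({x} : Finset α) ∈ partr r F := by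
    intro t
    induction t using Finset.strongInduction with
    | H t ih =>
    intro ht x hxt
    by_cases hsingle : t = {x}
    · rw [← hsingle]
      exact ht
    · obtain ⟨z, hzt, hzx⟩ : ∃ z ∈ t, z ≠ x := by
        by_contra hcon
        push Not at hcon
        exact hsingle (eq_singleton_iff_unique_mem.2 ⟨hxt, hcon⟩)
      exact ih (t.erase z) (erase_ssubset hzt) (herase t ht z hzt) x (mem_erase.2 ⟨Ne.symm hzx, hxt⟩)
  -- such an element lies in every member of `part0 r F`
  have hall : ∀ t ∈ partr r F, ∀ x ∈ t, ∀ s ∈ part0 r F, x ∈ s := by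
    intro t ht x hxt s hs
    by_contra hxs
    refine hnosing _ (hsing1 t ht x hxt) s hs x ?_
    ext z
    simp only [mem_sdiff, mem_singleton]
    constructor
    · rintro ⟨rfl, -⟩
      rfl
    · rintro rfl
      exact ⟨rfl, hxs⟩
  -- conclusion
  ext t
  rw [mem_singleton]
  constructor
  · intro ht
    by_contra hne
    obtain ⟨x, hxt⟩ := nonempty_iff_ne_empty.2 hne
    -- every `y ≠ r` lies in some member of `partr r F`
    have hcover : ∀ y, y ≠ r → ∃ t' ∈ partr r F, y ∈ t' := by
      intro y hy
      by_contra hcon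
      push Not at hcon
      have hyP := hsingP y hy
      rw [proj_eq_union, mem_union] at hyP
      rcases hyP with h | h
      · have hxy : x = y := mem_singleton.1 (hall t ht x hxt _ h)
        exact hcon t ht (hxy ▸ hxt)
      · exact hcon {y} h (mem_singleton_self y)
    -- hence every member of `part0 r F` is `univ \ {r}`
    obtain ⟨s, hs, hrs⟩ := hout r
    have hs0 : s ∈ part0 r F := mem_part0.2 ⟨hs, hrs⟩
    have hsuniv : s = univ \ {r} := by
      ext z
      simp only [mem_sdiff, mem_univ, mem_singleton, true_and]
      constructor
      · intro hz hzr
        exact hrs (hzr ▸ hz)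
      · intro hzr
        obtain ⟨t', ht', hzt'⟩ := hcover z hzr
        exact hall t' ht' z hzt' s hs0
    exact hval {r} hr (hsuniv ▸ hs)
  · rintro rfl
    exact h0

end EmptyPartner

end PercRepro.MSTight
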